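import Summits.AnomalousDissipation.AnomalousDissipation.Theses.RuelleSaturation

/-!
# KolmogorovHorizonChaos — typed decomposition, ASSEMBLY IN HYPOTHESIS FORM (crux-strategist, BC2 redirect)

Pieces `WindowDissipationFloor` (W, crux), `KolmogorovHorizonCapture` (K, crux), `FloorEternalisation` (Fl, support)
as `def … : Prop` (verbatim the statements of `SplitReady.md` / the stubs of `Lines/split_window_capture.lean`)
and the glue `KolmogorovHorizonChaos_of_subs : W → K → Fl → RuelleSaturation.KolmogorovHorizonChaos`, sorry-free.
This is the theorem a prover lands under `Theorems/RuelleSaturationKolmogorovHorizonChaosSplit.lean` (planners cannot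
write Theorems/), and the `--glue-by` candidate once `route edit --split KolmogorovHorizonChaos` is applied.
-/

open MeasureTheory Filter Topology Set
open Literature.Analysis.FunctionSpaces Literature.Analysis.FluidPDE

noncomputable section

namespace Summit.AnomalousDissipation.AnomalousDissipation.Cruxes.KolmogorovHorizonChaos.Split

/-- The inlined Lagrangian-flow interface of the route's cruxes (verbatim clauses). -/
def LagrFlow (u : ℝ → UnitAddTorus (Fin 3) → EuclideanSpace ℝ (Fin 3))
    (D : ℝ → ℝ → UnitAddTorus (Fin 3) → EuclideanSpace ℝ (Fin 3))
    (J : ℝ → ℝ → UnitAddTorus (Fin 3) → (EuclideanSpace ℝ (Fin 3) →L[ℝ] EuclideanSpace ℝ (Fin 3))) : Prop :=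
  (∀ t x, D t t x = 0) ∧
  (∀ t s x, HasDerivAt (fun r => D t r x) (u s (x + Literature.Analysis.FunctionSpaces.Torus.proj (D t s x))) s) ∧
  (∀ t x, J t t x = ContinuousLinearMap.id ℝ (EuclideanSpace ℝ (Fin 3))) ∧
  (∀ t s x, HasDerivAt (fun r => J t r x) ((Literature.Analysis.FunctionSpaces.Torus.fderiv (u s) (x + Literature.Analysis.FunctionSpaces.Torus.proj (D t s x))).comp (J t s x)) s) ∧
  (∀ t s, MeasureTheory.MeasurePreserving (fun x : UnitAddTorus (Fin 3) => x + Literature.Analysis.FunctionSpaces.Torus.proj (D t s x)) MeasureTheory.volume MeasureTheory.volume) ∧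
  Continuous (fun q : ℝ × ℝ × UnitAddTorus (Fin 3) => (D q.1 q.2.1 q.2.2, J q.1 q.2.1 q.2.2))

/-- Piece W (crux): TRANSIENT ZEROTH LAW AT BOUNDED ENERGY, level-wise smooth.  One steady force `f`,
viscosities `ν_j → 0` (`0 < ν_j ≤ 1`), uniform `E₀, c > 0, L₁`; for every level `j` a smoothness
budget `B_j : ℕ → ℝ`; for every window length `L ≥ L₁` a globally smooth, slice-wise divergence-free
field `u` (with a globally smooth pressure `p`) solving NS_{ν_j} with force `f` ON THE WINDOW `[0, L]`,
with `∫|u(t)|² ≤ E₀` on the window, all space–time derivatives of `u, p` bounded by `B_j` on the window,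
and windowed dissipation `ν_j ∫₀ᴸ ‖∇u‖² ≥ c·L`.  Data are re-chosen for every window: no single global
solution per level is asserted (that upgrade is the sibling `FloorEternalisation`), and nothing Lagrangian. -/
def WindowDissipationFloor : Prop :=
  ∃ f : UnitAddTorus (Fin 3) → EuclideanSpace ℝ (Fin 3), Literature.Analysis.FunctionSpaces.Torus.IsSmooth f ∧ Literature.Analysis.FunctionSpaces.Torus.IsDivFree f ∧ Literature.Analysis.FunctionSpaces.Torus.HasZeroMean f ∧
  ∃ ν : ℕ → ℝ, (∀ j, 0 < ν j ∧ ν j ≤ 1) ∧ Filter.Tendsto ν Filter.atTop (nhds 0) ∧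
  ∃ E₀ c L₁ : ℝ, 0 < c ∧ ∀ j, ∃ B : ℕ → ℝ, ∀ L : ℝ, L₁ ≤ L →
    ∃ (u : ℝ → UnitAddTorus (Fin 3) → EuclideanSpace ℝ (Fin 3)) (p : ℝ → UnitAddTorus (Fin 3) → ℝ),
      Literature.Analysis.FunctionSpaces.Torus.IsSmoothSpaceTimeOn Set.univ u ∧ Literature.Analysis.FunctionSpaces.Torus.IsSmoothSpaceTimeOn Set.univ p ∧
      (∀ t, Literature.Analysis.FunctionSpaces.Torus.IsDivFree (u t)) ∧
      Literature.Analysis.FunctionSpaces.Torus.IsClassicalNSSolutionOn (Set.Icc 0 L) (ν j) (fun _ => f) u p ∧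
      (∀ t ∈ Set.Icc 0 L, MeasureTheory.integral MeasureTheory.volume (fun x : UnitAddTorus (Fin 3) => ‖u t x‖ ^ 2) ≤ E₀) ∧
      (∀ k : ℕ, ∀ q ∈ (Set.Icc 0 L) ×ˢ (Set.univ : Set (EuclideanSpace ℝ (Fin 3))),
        ‖iteratedFDeriv ℝ k (Literature.Analysis.FunctionSpaces.Torus.stLift u) q‖ ≤ B k ∧ ‖iteratedFDeriv ℝ k (Literature.Analysis.FunctionSpaces.Torus.stLift p) q‖ ≤ B k) ∧
      c * L ≤ ν j * ∫ t in (0 : ℝ)..L, Literature.Analysis.FunctionSpaces.Torus.gradNormSq (u t)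

/-- Piece K (crux): KOLMOGOROV-HORIZON CAPTURE (universal; the route's physical bet).  For every smooth
steady divergence-free mean-zero force `f` and energy level `E₀` there are `M, κ > 0` and a transient
allowance `β` such that for every `0 < ν ≤ 1`, every window `[0, L + τ]`, `τ := √(ν/M)` (a fixed
fraction `M^{-1/2}` of the Kolmogorov time in the units where `ε = O(1)`), and every globally smooth
slice-wise divergence-free `u` solving NS_ν with force `f` on the window with `∫|u(t)|² ≤ E₀` there,
`u` admits Lagrangian flow data `(D, J)` (the inlined interface; they exist and are unique) whose
forward FTLE field over the horizon `τ` captures a fixed fraction of the windowed dissipation: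
`κ · ν ∫₀^{L+τ} ‖∇u‖² − β ≤ ν ∫₀ᴸ ∫ₓ (τ⁻¹ log ‖J(t, t+τ, x)‖)²`. -/
def KolmogorovHorizonCapture : Prop :=
  ∀ f : UnitAddTorus (Fin 3) → EuclideanSpace ℝ (Fin 3), Literature.Analysis.FunctionSpaces.Torus.IsSmooth f → Literature.Analysis.FunctionSpaces.Torus.IsDivFree f → Literature.Analysis.FunctionSpaces.Torus.HasZeroMean f →
  ∀ E₀ : ℝ, ∃ M κ β : ℝ, 0 < M ∧ 0 < κ ∧ ∀ ν : ℝ, 0 < ν → ν ≤ 1 → ∀ L : ℝ, 0 ≤ L →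
    ∀ (u : ℝ → UnitAddTorus (Fin 3) → EuclideanSpace ℝ (Fin 3)) (p : ℝ → UnitAddTorus (Fin 3) → ℝ),
      Literature.Analysis.FunctionSpaces.Torus.IsSmoothSpaceTimeOn Set.univ u → (∀ t, Literature.Analysis.FunctionSpaces.Torus.IsDivFree (u t)) →
      Literature.Analysis.FunctionSpaces.Torus.IsClassicalNSSolutionOn (Set.Icc 0 (L + Real.sqrt (ν / M))) ν (fun _ => f) u p →
      (∀ t ∈ Set.Icc 0 (L + Real.sqrt (ν / M)), MeasureTheory.integral MeasureTheory.volume (fun x : UnitAddTorus (Fin 3) => ‖u t x‖ ^ 2) ≤ E₀) →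
      ∃ (D : ℝ → ℝ → UnitAddTorus (Fin 3) → EuclideanSpace ℝ (Fin 3)) (J : ℝ → ℝ → UnitAddTorus (Fin 3) → (EuclideanSpace ℝ (Fin 3) →L[ℝ] EuclideanSpace ℝ (Fin 3))),
        ((∀ t x, D t t x = 0) ∧
          (∀ t s x, HasDerivAt (fun r => D t r x) (u s (x + Literature.Analysis.FunctionSpaces.Torus.proj (D t s x))) s) ∧
          (∀ t x, J t t x = ContinuousLinearMap.id ℝ (EuclideanSpace ℝ (Fin 3))) ∧
          (∀ t s x, HasDerivAt (fun r => J t r x) ((Literature.Analysis.FunctionSpaces.Torus.fderiv (u s) (x + Literature.Analysis.FunctionSpaces.Torus.proj (D t s x))).comp (J t s x)) s) ∧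
          (∀ t s, MeasureTheory.MeasurePreserving (fun x : UnitAddTorus (Fin 3) => x + Literature.Analysis.FunctionSpaces.Torus.proj (D t s x)) MeasureTheory.volume MeasureTheory.volume) ∧
          Continuous (fun q : ℝ × ℝ × UnitAddTorus (Fin 3) => (D q.1 q.2.1 q.2.2, J q.1 q.2.1 q.2.2))) ∧
        κ * (ν * ∫ t in (0 : ℝ)..(L + Real.sqrt (ν / M)), Literature.Analysis.FunctionSpaces.Torus.gradNormSq (u t)) - β ≤
          ν * ∫ t in (0 : ℝ)..L, MeasureTheory.integral MeasureTheory.volume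
            (fun x : UnitAddTorus (Fin 3) => ((Real.sqrt (ν / M))⁻¹ * Real.log ‖J t (t + Real.sqrt (ν / M)) x‖) ^ 2)

/-- Piece Fl (support; known-type analysis): FLOOR ETERNALISATION AT FIXED VISCOSITY.  Fix `ν > 0`, a
smooth steady force `f`, a horizon `τ > 0`, an energy level `E₀`, a threshold `L₀`, a rate `a` and a
smoothness budget `B`.  If for every window length `L ≥ L₀` there is a globally smooth slice-wise
divergence-free `u` (pressure `p`, Lagrangian data `(D, J)`) solving NS_ν with force `f` on `[0, L+τ]`
with `∫|u(t)|² ≤ E₀` and all space–time derivatives of `u, p` bounded by `B` there and FTLE window mass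
`∫₀ᴸ∫ₓ(τ⁻¹ log‖J(t,t+τ,x)‖)² ≥ a·L`, then there is an ETERNAL classical solution with Lagrangian data,
`∫|u(t)|² ≤ E₀` for all `t`, FTLE mass at most affine in `T`, and FTLE window mass `≥ (a/2)·T` for
arbitrarily long windows `[0, T]` (compactness after time shifts chosen by a tiling lemma for Cesàro
floors; ODE stability for `(D, J)`; any factor `θ < 1` in place of `1/2` would do). -/
def FloorEternalisation : Prop :=
  ∀ (ν : ℝ) (f : UnitAddTorus (Fin 3) → EuclideanSpace ℝ (Fin 3)) (τ E₀ L₀ a : ℝ) (B : ℕ → ℝ),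
    0 < ν → Literature.Analysis.FunctionSpaces.Torus.IsSmooth f → 0 < τ →
    (∀ L : ℝ, L₀ ≤ L →
      ∃ (u : ℝ → UnitAddTorus (Fin 3) → EuclideanSpace ℝ (Fin 3)) (p : ℝ → UnitAddTorus (Fin 3) → ℝ)
        (D : ℝ → ℝ → UnitAddTorus (Fin 3) → EuclideanSpace ℝ (Fin 3)) (J : ℝ → ℝ → UnitAddTorus (Fin 3) → (EuclideanSpace ℝ (Fin 3) →L[ℝ] EuclideanSpace ℝ (Fin 3))),
        Literature.Analysis.FunctionSpaces.Torus.IsSmoothSpaceTimeOn Set.univ u ∧ Literature.Analysis.FunctionSpaces.Torus.IsSmoothSpaceTimeOn Set.univ p ∧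
        (∀ t, Literature.Analysis.FunctionSpaces.Torus.IsDivFree (u t)) ∧
        Literature.Analysis.FunctionSpaces.Torus.IsClassicalNSSolutionOn (Set.Icc 0 (L + τ)) ν (fun _ => f) u p ∧
        ((∀ t x, D t t x = 0) ∧
          (∀ t s x, HasDerivAt (fun r => D t r x) (u s (x + Literature.Analysis.FunctionSpaces.Torus.proj (D t s x))) s) ∧
          (∀ t x, J t t x = ContinuousLinearMap.id ℝ (EuclideanSpace ℝ (Fin 3))) ∧
          (∀ t s x, HasDerivAt (fun r => J t r x) ((Literature.Analysis.FunctionSpaces.Torus.fderiv (u s) (x + Literature.Analysis.FunctionSpaces.Torus.proj (D t s x))).comp (J t s x)) s) ∧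
          (∀ t s, MeasureTheory.MeasurePreserving (fun x : UnitAddTorus (Fin 3) => x + Literature.Analysis.FunctionSpaces.Torus.proj (D t s x)) MeasureTheory.volume MeasureTheory.volume) ∧
          Continuous (fun q : ℝ × ℝ × UnitAddTorus (Fin 3) => (D q.1 q.2.1 q.2.2, J q.1 q.2.1 q.2.2))) ∧
        (∀ t ∈ Set.Icc 0 (L + τ), MeasureTheory.integral MeasureTheory.volume (fun x : UnitAddTorus (Fin 3) => ‖u t x‖ ^ 2) ≤ E₀) ∧
        (∀ k : ℕ, ∀ q ∈ (Set.Icc 0 (L + τ)) ×ˢ (Set.univ : Set (EuclideanSpace ℝ (Fin 3))),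
          ‖iteratedFDeriv ℝ k (Literature.Analysis.FunctionSpaces.Torus.stLift u) q‖ ≤ B k ∧ ‖iteratedFDeriv ℝ k (Literature.Analysis.FunctionSpaces.Torus.stLift p) q‖ ≤ B k) ∧
        a * L ≤ ∫ t in (0 : ℝ)..L, MeasureTheory.integral MeasureTheory.volume
          (fun x : UnitAddTorus (Fin 3) => (τ⁻¹ * Real.log ‖J t (t + τ) x‖) ^ 2)) →
    ∃ (u : ℝ → UnitAddTorus (Fin 3) → EuclideanSpace ℝ (Fin 3)) (p : ℝ → UnitAddTorus (Fin 3) → ℝ)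
      (D : ℝ → ℝ → UnitAddTorus (Fin 3) → EuclideanSpace ℝ (Fin 3)) (J : ℝ → ℝ → UnitAddTorus (Fin 3) → (EuclideanSpace ℝ (Fin 3) →L[ℝ] EuclideanSpace ℝ (Fin 3))),
      Literature.Analysis.FunctionSpaces.Torus.IsClassicalNSSolutionOn Set.univ ν (fun _ => f) u p ∧
      ((∀ t x, D t t x = 0) ∧
        (∀ t s x, HasDerivAt (fun r => D t r x) (u s (x + Literature.Analysis.FunctionSpaces.Torus.proj (D t s x))) s) ∧
        (∀ t x, J t t x = ContinuousLinearMap.id ℝ (EuclideanSpace ℝ (Fin 3))) ∧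
        (∀ t s x, HasDerivAt (fun r => J t r x) ((Literature.Analysis.FunctionSpaces.Torus.fderiv (u s) (x + Literature.Analysis.FunctionSpaces.Torus.proj (D t s x))).comp (J t s x)) s) ∧
        (∀ t s, MeasureTheory.MeasurePreserving (fun x : UnitAddTorus (Fin 3) => x + Literature.Analysis.FunctionSpaces.Torus.proj (D t s x)) MeasureTheory.volume MeasureTheory.volume) ∧
        Continuous (fun q : ℝ × ℝ × UnitAddTorus (Fin 3) => (D q.1 q.2.1 q.2.2, J q.1 q.2.1 q.2.2))) ∧
      (∀ t, MeasureTheory.integral MeasureTheory.volume (fun x : UnitAddTorus (Fin 3) => ‖u t x‖ ^ 2) ≤ E₀) ∧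
      (∃ Bd : ℝ, ∀ T : ℝ, 0 ≤ T → ∫ t in (0 : ℝ)..T, MeasureTheory.integral MeasureTheory.volume
          (fun x : UnitAddTorus (Fin 3) => (τ⁻¹ * Real.log ‖J t (t + τ) x‖) ^ 2) ≤ Bd * (T + 1)) ∧
      (∀ n : ℕ, ∃ T : ℝ, (n : ℝ) + 1 ≤ T ∧ a / 2 * T ≤ ∫ t in (0 : ℝ)..T, MeasureTheory.integral MeasureTheory.volume
          (fun x : UnitAddTorus (Fin 3) => (τ⁻¹ * Real.log ‖J t (t + τ) x‖) ^ 2))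

/-! ## Assembly -/

/-- Cesàro-floor lemma used by the assembly: if the running means of a real function are eventually
bounded above and exceed `b` on arbitrarily long windows `[0, T]`, then `b ≤ longTimeAvgSup g`. -/
theorem le_longTimeAvgSup_of_frequently {g : ℝ → ℝ} {b Bd : ℝ}
    (hBd : ∀ T : ℝ, 0 ≤ T → ∫ t in (0 : ℝ)..T, g t ≤ Bd * (T + 1))
    (hfreq : ∀ n : ℕ, ∃ T : ℝ, (n : ℝ) + 1 ≤ T ∧ b * T ≤ ∫ t in (0 : ℝ)..T, g t) :
    b ≤ Literature.Analysis.FluidPDE.longTimeAvgSup g := by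
  unfold Literature.Analysis.FluidPDE.longTimeAvgSup
  have hbdd : Filter.IsBoundedUnder (· ≤ ·) Filter.atTop (Literature.Analysis.FluidPDE.timeMean g) := by
    refine Filter.isBoundedUnder_of_eventually_le (a := |Bd| * 2) ?_
    filter_upwards [Filter.eventually_ge_atTop (1 : ℝ)] with T hT
    have hT0 : 0 < T := by linarith
    unfold Literature.Analysis.FluidPDE.timeMean
    have h1 : ∫ t in (0 : ℝ)..T, g t ≤ |Bd| * 2 * T := by
      calc ∫ t in (0 : ℝ)..T, g t ≤ Bd * (T + 1) := hBd T hT0.le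
        _ ≤ |Bd| * (T + 1) := by
            exact mul_le_mul_of_nonneg_right (le_abs_self Bd) (by linarith)
        _ ≤ |Bd| * 2 * T := by nlinarith [abs_nonneg Bd]
    rw [inv_mul_le_iff₀ hT0]
    linarith
  have hfr : ∃ᶠ T in Filter.atTop, b ≤ Literature.Analysis.FluidPDE.timeMean g T := by
    rw [Filter.frequently_atTop]
    intro T₀
    obtain ⟨T, hT, hbT⟩ := hfreq ⌈T₀⌉₊
    have hT0 : 0 < T := by
      have := Nat.cast_nonneg (α := ℝ) ⌈T₀⌉₊
      linarith
    refine ⟨T, ?_, ?_⟩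
    · have := Nat.le_ceil T₀
      linarith
    · unfold Literature.Analysis.FluidPDE.timeMean
      rw [le_inv_mul_iff₀ hT0]
      linarith
  exact Filter.le_limsup_of_frequently_le hfr hbdd

/-- **Assembly.** `W → K → Fl → KolmogorovHorizonChaos`: the horizons are `τ_j := √(ν_j/M)` with `M`
from K (so `ν_j = M τ_j²`); per level, W-windows on `[0, L + τ_j]` are given Lagrangian data and an
FTLE window floor `(κc/(2ν_j))·L` by K (for `L ≥ L₀ := max (max L₁ 0) (2β/(κc))`), eternalised by Fl;
the eternal witnesses' frequent window floors and affine mass bounds give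
`ν_j · limsup_T T⁻¹∫₀ᵀ ∫ₓ Λ² ≥ κc/4` uniformly in `j`. -/
theorem KolmogorovHorizonChaos_of_subs (hW : WindowDissipationFloor) (hK : KolmogorovHorizonCapture)
    (hE : FloorEternalisation) :
    Summit.AnomalousDissipation.AnomalousDissipation.Theses.RuelleSaturation.KolmogorovHorizonChaos := by
  obtain ⟨f, hfs, hfd, hfm, ν, hν, hν0, E₀, c, L₁, hc, hWj⟩ := hW
  obtain ⟨M, κ, β, hM, hκ, hKν⟩ := hK f hfs hfd hfm E₀
  have hτpos : ∀ j, 0 < Real.sqrt (ν j / M) := fun j => Real.sqrt_pos.2 (div_pos (hν j).1 hM)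
  have hτsq : ∀ j, ν j = M * Real.sqrt (ν j / M) ^ 2 := by
    intro j
    rw [Real.sq_sqrt (div_pos (hν j).1 hM).le]
    field_simp
  have hκc : 0 < κ * c := mul_pos hκ hc
  -- per-level eternal witnesses
  have key : ∀ j, ∃ (u : ℝ → UnitAddTorus (Fin 3) → EuclideanSpace ℝ (Fin 3)) (p : ℝ → UnitAddTorus (Fin 3) → ℝ)
      (D : ℝ → ℝ → UnitAddTorus (Fin 3) → EuclideanSpace ℝ (Fin 3)) (J : ℝ → ℝ → UnitAddTorus (Fin 3) → (EuclideanSpace ℝ (Fin 3) →L[ℝ] EuclideanSpace ℝ (Fin 3))),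
      Literature.Analysis.FunctionSpaces.Torus.IsClassicalNSSolutionOn Set.univ (ν j) (fun _ => f) u p ∧
      LagrFlow u D J ∧
      (∀ t, MeasureTheory.integral MeasureTheory.volume (fun x : UnitAddTorus (Fin 3) => ‖u t x‖ ^ 2) ≤ E₀) ∧
      (∃ Bd : ℝ, ∀ T : ℝ, 0 ≤ T → ∫ t in (0 : ℝ)..T, MeasureTheory.integral MeasureTheory.volume
          (fun x : UnitAddTorus (Fin 3) => ((Real.sqrt (ν j / M))⁻¹ * Real.log ‖J t (t + Real.sqrt (ν j / M)) x‖) ^ 2) ≤ Bd * (T + 1)) ∧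
      (∀ n : ℕ, ∃ T : ℝ, (n : ℝ) + 1 ≤ T ∧ (κ * c / (2 * ν j)) / 2 * T ≤ ∫ t in (0 : ℝ)..T, MeasureTheory.integral MeasureTheory.volume
          (fun x : UnitAddTorus (Fin 3) => ((Real.sqrt (ν j / M))⁻¹ * Real.log ‖J t (t + Real.sqrt (ν j / M)) x‖) ^ 2)) := by
    intro j
    obtain ⟨B, hB⟩ := hWj j
    have hνj := (hν j).1
    -- threshold
    set L₀ : ℝ := max (max L₁ 0) (2 * β / (κ * c)) with hL₀
    have hmain := hE (ν j) f (Real.sqrt (ν j / M)) E₀ L₀ (κ * c / (2 * ν j)) B hνj hfs (hτpos j)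
    refine hmain ?_
    intro L hL
    have hL1 : L₁ ≤ L := le_trans (le_trans (le_max_left _ _) (le_max_left _ _)) hL
    have hL0 : 0 ≤ L := le_trans (le_trans (le_max_right _ _) (le_max_left _ _)) hL
    have hLβ : 2 * β / (κ * c) ≤ L := le_trans (le_max_right _ _) hL
    have hLβ' : 2 * β ≤ κ * c * L := by
      rw [div_le_iff₀ hκc] at hLβ
      linarith
    obtain ⟨u, p, hu, hp, hdiv, hNS, hEn, hBud, hfloor⟩ :=
      hB (L + Real.sqrt (ν j / M)) (by linarith [(hτpos j).le])
    obtain ⟨D, J, hLF, hcap⟩ := hKν (ν j) hνj (hν j).2 L hL0 u p hu hdiv hNS hEn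
    refine ⟨u, p, D, J, hu, hp, hdiv, hNS, hLF, hEn, hBud, ?_⟩
    -- arithmetic: κ c (L + τ) - β ≤ ν · mass and κ c L ≥ 2β  ⟹  (κc/(2ν)) L ≤ mass
    set I₁ : ℝ := ∫ t in (0 : ℝ)..(L + Real.sqrt (ν j / M)), Literature.Analysis.FunctionSpaces.Torus.gradNormSq (u t) with hI₁
    set I₂ : ℝ := ∫ t in (0 : ℝ)..L, MeasureTheory.integral MeasureTheory.volume
          (fun x : UnitAddTorus (Fin 3) => ((Real.sqrt (ν j / M))⁻¹ * Real.log ‖J t (t + Real.sqrt (ν j / M)) x‖) ^ 2) with hI₂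
    have h1 : κ * (c * (L + Real.sqrt (ν j / M))) ≤ κ * (ν j * I₁) := mul_le_mul_of_nonneg_left hfloor hκ.le
    have h2 : 0 ≤ κ * c * Real.sqrt (ν j / M) := mul_nonneg hκc.le (hτpos j).le
    have h3 : κ * c * L ≤ 2 * (ν j * I₂) := by nlinarith
    rw [div_mul_eq_mul_div, div_le_iff₀ (by positivity)]
    nlinarith
  choose u p D J hNS hLF hEn hBd hfreq using key
  refine ⟨f, hfs, hfd, hfm, ν, fun j => Real.sqrt (ν j / M), u, p, D, J, fun j => (hν j).1, hν0, hNS, fun j => hLF j,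
    ⟨E₀, fun j t _ => hEn j t⟩, ⟨M, fun j => ⟨hτpos j, le_of_eq (hτsq j)⟩⟩, κ * c / 4, by positivity, ?_⟩
  intro j
  obtain ⟨Bd, hBd'⟩ := hBd j
  have hlim := le_longTimeAvgSup_of_frequently (b := (κ * c / (2 * ν j)) / 2) hBd' (hfreq j)
  have hνj := (hν j).1
  have : κ * c / 4 = ν j * ((κ * c / (2 * ν j)) / 2) := by field_simp; ring
  rw [this]
  exact mul_le_mul_of_nonneg_left hlim hνj.le

end Summit.AnomalousDissipation.AnomalousDissipation.Cruxes.KolmogorovHorizonChaos.Split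

end
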